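import Summits.BirchSwinnertonDyer.BirchSwinnertonDyer.Theorems.AlignedTransportAtTwoMainConjectureOfRankZeroBSDAtTwoFineRoadRelaxedFine
import Summits.BirchSwinnertonDyer.BirchSwinnertonDyer.Theorems.ThetaPartnerAtTwoSignedControlAtTwoH1SigmaRankOne
import Literature.NumberTheory.EllipticCurves.KatoFineSelmerDualRelaxedAtInfinity
import Literature.NumberTheory.EllipticCurves.H1SigmaDualFiniteProofs
import Literature.NumberTheory.EllipticCurves.IwasawaNakayamaProofs
import Literature.NumberTheory.EllipticCurves.IwasawaAlgebraCharIdealProofs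
import HarnessLib

/-!
# Road (b″) of crux C2 `MainConjectureOfRankZeroBSDAtTwo` (stmt-BirchSwinnertonDyer-22298), line `birth`:
# the relaxed-at-`∞` FINE Selmer dual `X₀^{rel ∞}(E/K_∞)` is a finitely generated `Λ`-module —
# UNCONDITIONALLY, for every number field, every prime, every `ℤ_p`-extension

HONEST FRAMING (cell `bsd-f1-sign2`, attach seat `bsd-line-att-p4` g5, route `AlignedTransportAtTwo`; BSD is NOT proved by any
of this; the crux C2 stays OPEN). THEOREMS ONLY; `--supports stmt-BirchSwinnertonDyer-22298`, C2-NEUTRAL.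

WHAT. The registered stub MuIneqʳ (`MuInequalityRelAtTwo`), the displayed Limʳ (`LimRelAtTwo`) and the netted Kato data
`KatoNetDataRelAtTwo` of the skeleton (`Cruxes/…/Lines/birth.lean` v9) are all phrased with the `(2)`-length `ℓ₍₂₎(Yr.X)` of
an arbitrary receptacle `Yr : W.FineSelmerDualDataRelaxedInf κ γ` (typer p600292) — the Pontryagin dual of the fine Selmer group
of `K_∞` relaxed at the archimedean places. The tree knew this dual to be finitely generated only CONDITIONALLY on statement
(A) in relaxed form (`LimRelUpstairs.module_finite_relaxed_of_finite_pTorsion`, att-p5 g4: from `Sel₀^{rel ∞}[p]` finite), while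
for the STRICT fine dual finite generation is unconditional (`FineSelmerDualData.module_finite`, `KatoFineSelmerFiniteProofs`).
Here the relaxed twin is proved UNCONDITIONALLY, by the argument of the sibling `…FineRoadArchReceptacle` (§1–§2):

* `fineSelmerInftyRelaxedInf_le_unramifiedOutside` — `Sel₀^{rel ∞}(K_∞, E[p^∞]) ⊆ H¹(K_Σ/K_∞, E[p^∞])` for EVERY `Σ ⊇ {v ∣ p, ∞}`
  (locally trivial at a finite place ⟹ unramified there: tree `X2.GreenbergVatsalTorsion.awayKer_le_unramKer`);
* `finite_setOf_fineRelaxedInf_pTorsion_conjH1_eq` — **`Sel₀^{rel ∞}(K_∞, E[p^∞])[𝔪] = {s | p s = 0, conj_γ s = s}` is FINITE** for a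
  topological generator `γ` (tree `finite_setOf_unramifiedOutside_pTorsion_conjH1_eq` with `Σ₀ = ∅`);
* **`module_finite_fineRelaxedInf`** — EVERY `Yr : W.FineSelmerDualDataRelaxedInf κ γ` has `Module.Finite Λ Yr.X` (dual Nakayama
  `IwasawaDual.IsDualPair.module_finite`); `exists_fineSelmerDualDataRelaxedInf_moduleFinite` — a finitely generated receptacle exists.

So the `(2)`-lengths in MuIneqʳ / Limʳ / K₂ⁿᵉᵗʳ are lengths of finitely generated `Λ`-modules, and the conclusion of Limʳ reads,
through att-p3 g5's `KleinCountingLambda.lengthAt_augIdealP_eq_zero_iff_isTorsion_and_muInvariant_eq_zero`, literally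
«`X₀^{rel ∞}(W/ℚ_∞)` is `Λ`-torsion with `μ = 0`».

References: R. Greenberg, LNM 1716 (1999), §1 p. 60, §4 p. 106 and p. 117; J. Coates, R. Sujatha, Math. Ann. 331 (2005) §3
(finite generation of `Y(E/F_∞)`); S. Lang, *Cyclotomic Fields I–II*, Ch. 5 §1; J. Silverman, AEC X.4.3.
-/

set_option autoImplicit false
-- the Theorems namespace of this sub repeats the summit name by design (D-0017 nested layout)
set_option linter.dupNamespace false

noncomputable section

open scoped Classical

namespace Summit.BirchSwinnertonDyer.BirchSwinnertonDyer.Theorems.AlignedTransportAtTwoFineRoad.RelaxedFineFinite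

open NumberField IsDedekindDomain Field WeierstrassCurve
open Literature.NumberTheory.EllipticCurves Literature.NumberTheory.EllipticCurves.IwasawaAlgebra
  Literature.NumberTheory.EllipticCurves.Module Literature.NumberTheory.EllipticCurves.GreenbergSelmer Literature.NumberTheory.EllipticCurves.GreenbergVatsal2000
  Literature.NumberTheory.GaloisRepresentations ZpExtension

universe u

variable {K : Type u} [Field K] [NumberField K] (W : WeierstrassCurve K) {p : ℕ} [Fact p.Prime] (κ : ZpExtension K p)
  {γ : Field.absoluteGaloisGroup K}

/-- **`Sel₀^{rel ∞}(K_∞, E[p^∞]) ⊆ H¹(K_Σ/K_∞, E[p^∞])` for every `Σ₀`** (any number field, prime, `ℤ_p`-extension): a class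
locally trivial at the chosen place above a finite `v ∤ p` (the fine condition `awayKer`, at every conjugate) is unramified there
(`X2.GreenbergVatsalTorsion.awayKer_le_unramKer`: `H ⊓ I_v ≤ H ⊓ D_v`). No archimedean condition is involved.
[cite: GreenbergVatsal2000, §2 p. 17] [cite: Greenberg1989, §1 p. 98] -/
theorem fineSelmerInftyRelaxedInf_le_unramifiedOutside (S₀ : Set (HeightOneSpectrum (𝓞 K))) :
    W.fineSelmerInftyRelaxedInf κ ≤ unramifiedOutside κ.kerSubgroup (W.geomPrimaryTorsion p) p S₀ := by
  intro s hs
  rw [mem_unramifiedOutside_iff]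
  intro v _ hpv σ
  have hs' : s ∈ strictSelmerGroupOverRelaxedInf κ.kerSubgroup (W.geomPrimaryTorsion p) p
      (fineData (W.geomPrimaryTorsion p) p) := hs
  have h := ((mem_strictSelmerGroupOverRelaxedInf_iff s).mp hs').1 v hpv σ
  exact Summit.BirchSwinnertonDyer.Rank1Residual.X2.GreenbergVatsalTorsion.awayKer_le_unramKer
    (H := κ.kerSubgroup) (M := W.geomPrimaryTorsion p) v h

/-- **`Sel₀^{rel ∞}(K_∞, E[p^∞])[𝔪]` is FINITE**: for an elliptic `W` over a number field, any prime `p`, any `ℤ_p`-extension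
`κ` with topological generator `γ`, the set of relaxed-at-`∞` fine Selmer classes killed by `p` and fixed by `conj_γ` is finite
(a subset of `H¹(K_Σ/K_∞, E[p^∞])[𝔪]`, `Σ₀ = ∅`, finite by the tree's `finite_setOf_unramifiedOutside_pTorsion_conjH1_eq`).
[cite: GreenbergLNM1716, §1 p. 60 and §4 p. 117] [cite: SilvermanAEC2009, Lemma X.4.3] -/
theorem finite_setOf_fineRelaxedInf_pTorsion_conjH1_eq [W.IsElliptic] (hγ : κ.IsTopGenerator γ) :
    Set.Finite {s : W.fineSelmerInftyRelaxedInf κ |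
      p • s = 0 ∧ W.conjH1 p κ.kerSubgroup γ (s : W.subgroupH1 p κ.kerSubgroup) = s} := by
  have hfin := W.finite_setOf_unramifiedOutside_pTorsion_conjH1_eq (p := p) κ hγ
    (Set.finite_empty : (∅ : Set (HeightOneSpectrum (𝓞 K))).Finite)
  refine (hfin.preimage Subtype.val_injective.injOn).subset ?_
  rintro s ⟨hsp, hsγ⟩
  refine ⟨fineSelmerInftyRelaxedInf_le_unramifiedOutside W κ ∅ s.2, ?_, hsγ⟩
  have h1 := congrArg (fun z : W.fineSelmerInftyRelaxedInf κ ↦ (z : W.subgroupH1 p κ.kerSubgroup)) hsp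
  simpa using h1

/-- **`X₀^{rel ∞}(E/K_∞)` is a finitely generated `Λ`-module — for EVERY receptacle `Yr : W.FineSelmerDualDataRelaxedInf κ γ`**,
every elliptic `W` over a number field, every prime `p` and every `ℤ_p`-extension with topological generator `γ`; no reduction,
image, or statement-(A) hypothesis (contrast `LimRelUpstairs.module_finite_relaxed_of_finite_pTorsion`). Dual Nakayama
(`IwasawaDual.IsDualPair.module_finite`, Lang Ch. 5 §1) with the finiteness of `Sel₀^{rel ∞}[𝔪]`; the relaxed twin of
`FineSelmerDualData.module_finite` (Coates–Sujatha: `Y(E/F_∞)` is finitely generated over `Λ(Γ)`).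
[cite: CoatesSujatha2005, §3] [cite: Lang1990, Ch. 5 §1 (Nakayama's lemma)] [cite: GreenbergLNM1716, §1 p. 60 (after Conj. 1.3)] -/
theorem module_finite_fineRelaxedInf [W.IsElliptic] (hγ : κ.IsTopGenerator γ) (Yr : W.FineSelmerDualDataRelaxedInf κ γ) :
    Module.Finite (IwasawaAlgebra p) Yr.X := by
  have h := W.isLocNil_conjFineSelmerInftyRelaxedInf_sub_one κ hγ
  have hpair : IwasawaDual.IsDualPair p (W.conjFineSelmerInftyRelaxedInf κ γ - 1) Yr.toDual :=
    { bijective := Yr.bijective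
      T_smul := fun x s ↦ by
        rw [Yr.toDual_T_smul, IwasawaDual.End_sub_apply, AddMonoid.End.one_apply, map_sub]
        rfl
      C_smul := fun c x s k hk ↦ Yr.toDual_C_smul c x s k hk
      locNil := h }
  refine hpair.module_finite ((finite_setOf_fineRelaxedInf_pTorsion_conjH1_eq W κ hγ).subset ?_)
  intro s hs
  obtain ⟨hs1, hs2⟩ := hs
  rw [pow_one] at hs1 hs2
  rw [IwasawaDual.End_sub_apply, AddMonoid.End.one_apply, sub_eq_zero] at hs2
  refine ⟨hs1, ?_⟩
  have h2 := congrArg (fun z : W.fineSelmerInftyRelaxedInf κ ↦ (z : W.subgroupH1 p κ.kerSubgroup)) hs2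
  simpa using h2

/-- **A finitely generated receptacle of `X₀^{rel ∞}(E/K_∞)` EXISTS** for `γ` a topological generator: the typer's canonical datum
`W.fineSelmerDualDataRelaxedInf κ hγ` (p600292) is finitely generated over `Λ`. [cite: CoatesSujatha2005, §3]
[cite: GreenbergLNM1716, §1 p. 60 (after Conj. 1.3)] -/
theorem exists_fineSelmerDualDataRelaxedInf_moduleFinite [W.IsElliptic] (hγ : κ.IsTopGenerator γ) :
    ∃ Yr : W.FineSelmerDualDataRelaxedInf κ γ, Module.Finite (IwasawaAlgebra p) Yr.X :=
  ⟨W.fineSelmerDualDataRelaxedInf κ hγ, module_finite_fineRelaxedInf W κ hγ _⟩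

/-- **The `(p)`-length of `X₀^{rel ∞}(E/K_∞)` is the `(p)`-length of a finitely generated `Λ`-module; in particular it does not
depend on the receptacle**: two receptacles `Yr, Yr'` have the same `ℓ_𝔭` at every prime `𝔭` of `Λ` (they are `Λ`-isomorphic
quotients of each other: both `Λ`-actions read through the pinnings are the canonical one, `RelaxedRestrict.relaxedFineDual_toDual_smul`).
[cite: GreenbergLNM1716, §1 (after Conj. 1.3)] -/
theorem lengthAt_eq_of_fineRelaxedInf (hγ : κ.IsTopGenerator γ) (Yr Yr' : W.FineSelmerDualDataRelaxedInf κ γ)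
    (𝔭 : PrimeSpectrum (IwasawaAlgebra p)) :
    lengthAt (IwasawaAlgebra p) Yr.X 𝔭 = lengthAt (IwasawaAlgebra p) Yr'.X 𝔭 := by
  -- the comparison map `e : Yr.X → Yr'.X`, `Yr'.toDual (e x) = Yr.toDual x`, is `Λ`-linear and bijective
  set E' := AddEquiv.ofBijective Yr'.toDual Yr'.bijective with hE'
  have hE'_apply : ∀ χ, Yr'.toDual (E'.symm χ) = χ := fun χ ↦ E'.apply_symm_apply χ
  let e : Yr.X →ₗ[IwasawaAlgebra p] Yr'.X :=
    { toFun := fun x ↦ E'.symm (Yr.toDual x)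
      map_add' := fun x y ↦ by rw [map_add, map_add]
      map_smul' := fun f x ↦ by
        apply Yr'.bijective.injective
        rw [RingHom.id_apply, hE'_apply, RelaxedRestrict.relaxedFineDual_toDual_smul W κ hγ Yr',
          hE'_apply, RelaxedRestrict.relaxedFineDual_toDual_smul W κ hγ Yr] }
  have he_apply : ∀ x, Yr'.toDual (e x) = Yr.toDual x := fun x ↦ hE'_apply _
  have he : Function.Bijective e := by
    refine ⟨fun x y hxy ↦ Yr.bijective.injective ?_, fun y ↦ ?_⟩
    · rw [← he_apply x, ← he_apply y, hxy]
    · obtain ⟨x, hx⟩ := Yr.bijective.surjective (Yr'.toDual y)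
      exact ⟨x, Yr'.bijective.injective (by rw [he_apply, hx])⟩
  exact lengthAt_eq_of_linearEquiv (LinearEquiv.ofBijective e he) 𝔭

end Summit.BirchSwinnertonDyer.BirchSwinnertonDyer.Theorems.AlignedTransportAtTwoFineRoad.RelaxedFineFinite

end
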